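import Summits.MatrixMultiplication.OmegaCensus.SmallFormats.InvertiblePointDeltaLawFinal
import HarnessLib

/-!
# ω-census family (a): the SPLIT of a near-frame point and the QUARTER LAW for `⟨2,2,n⟩` (any field)

Cell `pub-omega` (unit `pub-omega-tensor`, gen 35), topic `Summits/MatrixMultiplication/OmegaCensus` (sub-folder
`SmallFormats`). Framing (verbatim): lottery ticket; floor = certified bounds/negative ranges. HONEST FRAMING: an elementary
re-bracketing of Brent's identity plus the final δ-law (`DeltaLaw.seven_mul_le_two_mul_of_saturated`, p660276) as a black box;
no search, no engine; nothing here is a bound on `ω`.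

**The split (`split`).** Let `β` compute `X ↦ XY` (`X ∈ k^{2×2}`, `Y ∈ k^{2×n}`) with `r` terms and let `O ⊇ {i : f_i(1) ≠ 0}`
(with `f_i(1) ≠ 0` on `O`). If the outputs `W_s`, `s ∈ O`, satisfy a linear relation `Σ_{s∈O} ρ_s W_s = 0` with `ρ_{j₀} ≠ 0`
(`j₀ ∈ O`) — automatic as soon as `|O| > 2n` — put `c_s := f_s/f_s(1)`, `D(X) := Σ_{s∈O} ρ_s c_s(X) W_s` (so `D(1) = 0`),
`σ̃ := (f_{j₀}(1)/ρ_{j₀})·g_{j₀}` and `g̃_s := g_s − (ρ_s f_{j₀}(1)/(ρ_{j₀} f_s(1)))·g_{j₀}`. Then (pure algebra)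
`XY = Σ_{s ≠ j₀} f_s(X) g̃_s(Y) W_s + σ̃(Y)·D(X)`, and `D(X) = (X₀₀ − X₁₁)·D(E₀₀) + X₀₁·D(E₀₁) + X₁₀·D(E₁₀)`: an HONEST bilinear
computation of `⟨2,2,n⟩` with `r + 2` terms (term `j₀` replaced by three terms whose X-forms vanish at `1`), indexed by
`ι ⊕ Fin 2`, whose X-forms nonvanishing at `1` are exactly those of `O ∖ {j₀}`.
**Consequences.** (`seven_mul_le_of_card_eq_add`) by induction on `d`, an invertible point at which exactly `2n + d` X-forms are
nonzero yields a SATURATED point of an `(r + 2d)`-term scheme, so the final δ-law gives `7n ≤ 2(r + 2d)` — the **quarter law**: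
at every invertible point at least `2n + ⌈(7n − 2r)/4⌉` X-forms are nonzero (`fifteen_mul_le`); in particular a NEAR point
(`d = 1`) needs `2r + 4 ≥ 7n` (`seven_mul_le_two_mul_add_four_of_near`), and below `(7n − 4)/2` terms every invertible point has
at least `2n + 2` nonvanishing X-forms (`two_mul_add_two_le_card_filter_ne`), e.g. 36-term `⟨2,2,11⟩`, 43-term `⟨2,2,13⟩`,
46-term `⟨2,2,14⟩` (floor rungs of the `𝔽₃` census). The refined accounting (K-side cost 1, W-side cost = rank of the defect
space modulo `span{W_t}`) is NOT in this file.
-/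

namespace Summit.MatrixMultiplication.OmegaCensus.SmallFormats

open Module Matrix Literature.Computability.AlgebraicComplexity
open Summit.MatrixMultiplication.OmegaCensus.RankOnePlaneCapGeneral

namespace NearSplit

variable {k : Type*} [Field k] {n : ℕ} {ι : Type*} [Fintype ι] [DecidableEq ι]

/-! ## Three X-forms vanishing at `1` and the decomposition of a linear map killing `1` -/

/-- The entry form `X ↦ X p q` on `2 × 2` matrices. -/
def entryForm (p q : Fin 2) : Module.Dual k (Matrix (Fin 2) (Fin 2) k) where
  toFun X := X p q
  map_add' _ _ := rfl
  map_smul' _ _ := rfl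

/-- `entryForm p q X = X p q`. -/
@[simp] theorem entryForm_apply (p q : Fin 2) (X : Matrix (Fin 2) (Fin 2) k) : entryForm p q X = X p q := rfl

/-- The three X-forms of the split: `X₀₀ − X₁₁`, `X₀₁`, `X₁₀` (a basis of the forms vanishing at `1`). -/
def mu : Fin 3 → Module.Dual k (Matrix (Fin 2) (Fin 2) k) :=
  ![entryForm 0 0 - entryForm 1 1, entryForm 0 1, entryForm 1 0]

/-- The three matrices `E₀₀, E₀₁, E₁₀`. -/
def ee : Fin 3 → Matrix (Fin 2) (Fin 2) k := ![single 0 0 1, single 0 1 1, single 1 0 1]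

/-- The forms `μ_i` vanish at `1`. -/
theorem mu_one (i : Fin 3) : mu i (1 : Matrix (Fin 2) (Fin 2) k) = 0 := by
  fin_cases i <;> simp [mu]

/-- `X = X₁₁·1 + Σ_i μ_i(X)·E_i`. -/
theorem eq_smul_one_add_sum (X : Matrix (Fin 2) (Fin 2) k) :
    X = X 1 1 • (1 : Matrix (Fin 2) (Fin 2) k) + ∑ i : Fin 3, mu i X • ee i := by
  ext p q
  rw [Fin.sum_univ_three]
  fin_cases p <;> fin_cases q <;> simp [mu, ee, Matrix.single]

/-- A linear map killing `1` is recovered from its values on `E₀₀, E₀₁, E₁₀`: `Φ X = Σ_i μ_i(X)·Φ(E_i)`. -/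
theorem map_eq_sum_mu {M : Type*} [AddCommGroup M] [Module k M] (Φ : Matrix (Fin 2) (Fin 2) k →ₗ[k] M)
    (h1 : Φ 1 = 0) (X : Matrix (Fin 2) (Fin 2) k) : Φ X = ∑ i : Fin 3, mu i X • Φ (ee i) := by
  conv_lhs => rw [eq_smul_one_add_sum X]
  rw [map_add, map_smul, h1, smul_zero, zero_add, map_sum]
  exact Finset.sum_congr rfl fun i _ => by rw [map_smul]

/-! ## The defect output map and the split computation -/

/-- The defect output map `D(X) = Σ_s ρ_s·(f_s(X) f_s(1)⁻¹)·W_s` (summed over all of `ι`; the terms with `f_s(1) = 0` drop out since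
`0⁻¹ = 0`). -/
def defectOut (β : BilinComp (mulBilin k 2 2 n) ι) (ρ : ι → k) :
    Matrix (Fin 2) (Fin 2) k →ₗ[k] Matrix (Fin 2) (Fin n) k :=
  ∑ s, (ρ s * (β.f s 1)⁻¹) • (β.f s).smulRight (β.w s)

omit [DecidableEq ι] in
/-- `D(X) = Σ_s (ρ_s f_s(X) f_s(1)⁻¹)·W_s`. -/
theorem defectOut_apply (β : BilinComp (mulBilin k 2 2 n) ι) (ρ : ι → k) (X : Matrix (Fin 2) (Fin 2) k) :
    defectOut β ρ X = ∑ s, (ρ s * (β.f s X * (β.f s 1)⁻¹)) • β.w s := by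
  simp only [defectOut, LinearMap.coe_sum, Finset.sum_apply, LinearMap.smul_apply, LinearMap.smulRight_apply, smul_smul]
  exact Finset.sum_congr rfl fun s _ => by ring_nf

omit [DecidableEq ι] in
/-- `D(1) = 0` when `ρ` is a relation among the outputs of the terms not vanishing at `1`. -/
theorem defectOut_one (β : BilinComp (mulBilin k 2 2 n) ι) (O : Finset ι) (hO : ∀ i, i ∉ O → β.f i 1 = 0)
    (hO' : ∀ i ∈ O, β.f i 1 ≠ 0) (ρ : ι → k) (hrel : ∑ s ∈ O, ρ s • β.w s = 0) : defectOut β ρ 1 = 0 := by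
  rw [defectOut_apply, ← Finset.sum_subset (Finset.subset_univ O), ← hrel]
  · refine Finset.sum_congr rfl fun s hs => ?_
    rw [mul_inv_cancel₀ (hO' s hs), mul_one]
  · intro s _ hs
    rw [hO s hs, zero_mul, mul_zero, zero_smul]

section Split

variable (β : BilinComp (mulBilin k 2 2 n) ι) (ρ : ι → k) (j₀ : ι)

/-- The X-forms of the split: term `j₀` becomes `μ₀ = X₀₀ − X₁₁`, the two new terms carry `μ₁ = X₀₁`, `μ₂ = X₁₀`. -/
def splitF : ι ⊕ Fin 2 → Module.Dual k (Matrix (Fin 2) (Fin 2) k) :=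
  Sum.elim (fun s => if s = j₀ then mu 0 else β.f s) (fun i => mu i.succ)

/-- The Y-forms of the split: `g̃_s = g_s − (ρ_s f_s(1)⁻¹ ρ_{j₀}⁻¹ f_{j₀}(1))·g_{j₀}` for `s ≠ j₀`, and `σ̃ = (ρ_{j₀}⁻¹ f_{j₀}(1))·g_{j₀}`
on the three defect terms. -/
def splitG : ι ⊕ Fin 2 → Module.Dual k (Matrix (Fin 2) (Fin n) k) :=
  Sum.elim (fun s => if s = j₀ then ((ρ j₀)⁻¹ * β.f j₀ 1) • β.g j₀
      else β.g s - (ρ s * (β.f s 1)⁻¹ * ((ρ j₀)⁻¹ * β.f j₀ 1)) • β.g j₀)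
    (fun _ => ((ρ j₀)⁻¹ * β.f j₀ 1) • β.g j₀)

/-- The outputs of the split: `W_s` for `s ≠ j₀`, and `D(E₀₀), D(E₀₁), D(E₁₀)` on the three defect terms. -/
def splitW : ι ⊕ Fin 2 → Matrix (Fin 2) (Fin n) k :=
  Sum.elim (fun s => if s = j₀ then defectOut β ρ (ee 0) else β.w s) (fun i => defectOut β ρ (ee i.succ))

variable {β ρ j₀}

/-- **The split computes `XY`.** (Pure algebra: `Σ_{s≠j₀} f_s g̃_s W_s = Σ_{s≠j₀} f_s g_s W_s − σ̃(Y)·(D(X) − ρ_{j₀}c_{j₀}(X)W_{j₀})`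
and `σ̃(Y) ρ_{j₀} c_{j₀}(X) = f_{j₀}(X) g_{j₀}(Y)`; the three defect terms sum to `σ̃(Y)·D(X)` because `D(1) = 0`.) -/
theorem split_sum_eq (O : Finset ι) (hO : ∀ i, i ∉ O → β.f i 1 = 0) (hO' : ∀ i ∈ O, β.f i 1 ≠ 0)
    (hrel : ∑ s ∈ O, ρ s • β.w s = 0) (hj₀ : j₀ ∈ O) (hρ : ρ j₀ ≠ 0)
    (X : Matrix (Fin 2) (Fin 2) k) (Y : Matrix (Fin 2) (Fin n) k) :
    ∑ i, (splitF β j₀ i X * splitG β ρ j₀ i Y) • splitW β ρ j₀ i = X * Y := by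
  -- abbreviations
  set σt : k := (ρ j₀)⁻¹ * β.f j₀ 1 * β.g j₀ Y with hσt
  have hD1 : defectOut β ρ 1 = 0 := defectOut_one β O hO hO' ρ hrel
  -- the three defect terms sum to `σ̃(Y) • D(X)`
  have hdef : (mu 0 X * σt) • defectOut β ρ (ee 0) + ∑ i : Fin 2, (mu i.succ X * σt) • defectOut β ρ (ee i.succ) =
      σt • defectOut β ρ X := by
    rw [map_eq_sum_mu (defectOut β ρ) hD1 X, Finset.smul_sum, Fin.sum_univ_three, Fin.sum_univ_two]
    simp only [smul_smul, mul_comm σt, Fin.succ_zero_eq_one, Fin.succ_one_eq_two, add_assoc]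
  -- split the `ι`-sum at `j₀`
  rw [Fintype.sum_sum_type]
  have hinl : ∀ s, (splitF β j₀ (Sum.inl s) X * splitG β ρ j₀ (Sum.inl s) Y) • splitW β ρ j₀ (Sum.inl s) =
      if s = j₀ then (mu 0 X * σt) • defectOut β ρ (ee 0)
      else (β.f s X * β.g s Y) • β.w s - (σt * (ρ s * (β.f s X * (β.f s 1)⁻¹))) • β.w s := by
    intro s
    by_cases hs : s = j₀
    · subst hs
      simp only [splitF, splitG, splitW, Sum.elim_inl, if_true, LinearMap.smul_apply, smul_eq_mul, hσt, mul_assoc]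
    · simp only [splitF, splitG, splitW, Sum.elim_inl, if_neg hs, LinearMap.sub_apply, LinearMap.smul_apply, smul_eq_mul,
        ← sub_smul, hσt]
      congr 1
      ring
  have hinr : ∀ i : Fin 2, (splitF β j₀ (Sum.inr i) X * splitG β ρ j₀ (Sum.inr i) Y) • splitW β ρ j₀ (Sum.inr i) =
      (mu i.succ X * σt) • defectOut β ρ (ee i.succ) := by
    intro i
    simp only [splitF, splitG, splitW, Sum.elim_inr, LinearMap.smul_apply, smul_eq_mul, hσt, mul_assoc]
  simp_rw [hinl, hinr]
  rw [Finset.sum_ite, Finset.filter_eq' Finset.univ j₀, if_pos (Finset.mem_univ j₀), Finset.sum_singleton,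
    Finset.sum_sub_distrib]
  -- regroup: defect pieces
  have hA : (mu 0 X * σt) • defectOut β ρ (ee 0) + ∑ i : Fin 2, (mu i.succ X * σt) • defectOut β ρ (ee i.succ) =
      ∑ s, (σt * (ρ s * (β.f s X * (β.f s 1)⁻¹))) • β.w s := by
    rw [hdef, defectOut_apply, Finset.smul_sum]
    exact Finset.sum_congr rfl fun s _ => by rw [smul_smul]
  -- the `j₀`-term of the defect sum is the original term `j₀`
  have hj : (σt * (ρ j₀ * (β.f j₀ X * (β.f j₀ 1)⁻¹))) • β.w j₀ = (β.f j₀ X * β.g j₀ Y) • β.w j₀ := by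
    congr 1
    rw [hσt]
    field_simp [hρ, hO' j₀ hj₀]
  -- assemble
  have hB := β.map_eq_sum X Y
  rw [mulBilin_apply] at hB
  rw [hB]
  have hsplitO : ∑ s, (β.f s X * β.g s Y) • β.w s =
      ∑ s ∈ Finset.univ.filter (fun s => ¬ s = j₀), (β.f s X * β.g s Y) • β.w s + (β.f j₀ X * β.g j₀ Y) • β.w j₀ := by
    rw [← Finset.sum_filter_add_sum_filter_not Finset.univ (fun s => ¬ s = j₀)]
    congr 1
    rw [show Finset.univ.filter (fun s => ¬¬s = j₀) = {j₀} by ext s; simp, Finset.sum_singleton]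
  have hsplitD : ∑ s, (σt * (ρ s * (β.f s X * (β.f s 1)⁻¹))) • β.w s =
      ∑ s ∈ Finset.univ.filter (fun s => ¬ s = j₀), (σt * (ρ s * (β.f s X * (β.f s 1)⁻¹))) • β.w s +
        (σt * (ρ j₀ * (β.f j₀ X * (β.f j₀ 1)⁻¹))) • β.w j₀ := by
    rw [← Finset.sum_filter_add_sum_filter_not Finset.univ (fun s => ¬ s = j₀)]
    congr 1
    rw [show Finset.univ.filter (fun s => ¬¬s = j₀) = {j₀} by ext s; simp, Finset.sum_singleton]
  rw [hsplitO, ← hj]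
  -- now both sides are sums of the same pieces
  have key : (mu 0 X * σt) • defectOut β ρ (ee 0) +
      (∑ s ∈ Finset.univ.filter (fun s => ¬ s = j₀), (β.f s X * β.g s Y) • β.w s -
        ∑ s ∈ Finset.univ.filter (fun s => ¬ s = j₀), (σt * (ρ s * (β.f s X * (β.f s 1)⁻¹))) • β.w s) +
      ∑ i : Fin 2, (mu i.succ X * σt) • defectOut β ρ (ee i.succ) =
      ∑ s ∈ Finset.univ.filter (fun s => ¬ s = j₀), (β.f s X * β.g s Y) • β.w s +
        ((mu 0 X * σt) • defectOut β ρ (ee 0) + ∑ i : Fin 2, (mu i.succ X * σt) • defectOut β ρ (ee i.succ)) -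
        ∑ s ∈ Finset.univ.filter (fun s => ¬ s = j₀), (σt * (ρ s * (β.f s X * (β.f s 1)⁻¹))) • β.w s := by abel
  rw [key, hA, hsplitD]
  abel

/-- **The split computation** of `⟨2,2,n⟩` with `r + 2` terms (given a relation `ρ` among the outputs of `O` with `ρ_{j₀} ≠ 0`). -/
def split (O : Finset ι) (hO : ∀ i, i ∉ O → β.f i 1 = 0) (hO' : ∀ i ∈ O, β.f i 1 ≠ 0)
    (hrel : ∑ s ∈ O, ρ s • β.w s = 0) (hj₀ : j₀ ∈ O) (hρ : ρ j₀ ≠ 0) : BilinComp (mulBilin k 2 2 n) (ι ⊕ Fin 2) where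
  f := splitF β j₀
  g := splitG β ρ j₀
  w := splitW β ρ j₀
  map_eq_sum X Y := by rw [mulBilin_apply, split_sum_eq O hO hO' hrel hj₀ hρ X Y]

/-- The X-forms of the split at `1`: zero off `O ∖ {j₀}` (pushed through `inl`). -/
theorem split_f_one_eq_zero (O : Finset ι) (hO : ∀ i, i ∉ O → β.f i 1 = 0) (hO' : ∀ i ∈ O, β.f i 1 ≠ 0)
    (hrel : ∑ s ∈ O, ρ s • β.w s = 0) (hj₀ : j₀ ∈ O) (hρ : ρ j₀ ≠ 0) (i : ι ⊕ Fin 2)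
    (hi : i ∉ (O.erase j₀).map Function.Embedding.inl) : (split O hO hO' hrel hj₀ hρ).f i 1 = 0 := by
  rcases i with s | t
  · change splitF β j₀ (Sum.inl s) 1 = 0
    simp only [splitF, Sum.elim_inl]
    by_cases hs : s = j₀
    · rw [if_pos hs]; exact mu_one 0
    · rw [if_neg hs]
      apply hO
      intro hsO
      exact hi (Finset.mem_map.mpr ⟨s, Finset.mem_erase.mpr ⟨hs, hsO⟩, rfl⟩)
  · change splitF β j₀ (Sum.inr t) 1 = 0
    simp only [splitF, Sum.elim_inr]
    exact mu_one _

/-- The X-forms of the split at `1`: nonzero on `O ∖ {j₀}` (pushed through `inl`). -/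
theorem split_f_one_ne_zero (O : Finset ι) (hO : ∀ i, i ∉ O → β.f i 1 = 0) (hO' : ∀ i ∈ O, β.f i 1 ≠ 0)
    (hrel : ∑ s ∈ O, ρ s • β.w s = 0) (hj₀ : j₀ ∈ O) (hρ : ρ j₀ ≠ 0) (i : ι ⊕ Fin 2)
    (hi : i ∈ (O.erase j₀).map Function.Embedding.inl) : (split O hO hO' hrel hj₀ hρ).f i 1 ≠ 0 := by
  obtain ⟨s, hs, rfl⟩ := Finset.mem_map.mp hi
  obtain ⟨hsj, hsO⟩ := Finset.mem_erase.mp hs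
  change splitF β j₀ (Sum.inl s) 1 ≠ 0
  simp only [splitF, Sum.elim_inl, if_neg hsj]
  exact hO' s hsO

end Split

/-! ## A relation among the outputs exists as soon as `|O| > 2n` -/

omit [DecidableEq ι] in
/-- More than `2n` vectors of `k^{2×n}` are linearly dependent: a nontrivial relation supported on `O`. -/
theorem exists_relation (β : BilinComp (mulBilin k 2 2 n) ι) (O : Finset ι) (hcard : 2 * n < O.card) :
    ∃ ρ : ι → k, (∑ s ∈ O, ρ s • β.w s = 0) ∧ ∃ j₀ ∈ O, ρ j₀ ≠ 0 := by
  classical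
  have hdep : ¬ LinearIndependent k (fun s : O => β.w (s : ι)) := by
    intro hli
    have h := hli.fintype_card_le_finrank
    rw [Fintype.card_coe, finrank_matrix_fin] at h
    omega
  obtain ⟨g, hg, ⟨s₀, hs₀⟩⟩ := Fintype.not_linearIndependent_iff.mp hdep
  refine ⟨fun i => if h : i ∈ O then g ⟨i, h⟩ else 0, ?_, s₀, s₀.2, by simpa using hs₀⟩
  rw [← Finset.sum_coe_sort O]
  convert hg using 2 with s
  simp [s.2]

/-! ## The quarter law -/

/-- **`|O| = 2n + d` at `X₀ = 1` forces `7n ≤ 2(r + 2d)`** — induction on `d`: the split lowers `d` by one and raises `r` by two; at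
`d = 0` this is the final δ-law. -/
theorem seven_mul_le_of_card_eq_add [DecidableEq k] (d : ℕ) :
    ∀ {ι : Type*} [Fintype ι] [DecidableEq ι] (β : BilinComp (mulBilin k 2 2 n) ι) (O : Finset ι),
      (∀ i, i ∉ O → β.f i 1 = 0) → (∀ i ∈ O, β.f i 1 ≠ 0) → O.card = 2 * n + d →
      7 * n ≤ 2 * (Fintype.card ι + 2 * d) := by
  induction d with
  | zero =>
    intro ι _ _ β O hO hO' hcard
    have hfilter : (Finset.univ.filter fun i => β.f i 1 ≠ 0) = O := by
      ext i
      simp only [Finset.mem_filter, Finset.mem_univ, true_and]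
      exact ⟨fun h => by by_contra hi; exact h (hO i hi), fun h => hO' i h⟩
    have h := DeltaLaw.seven_mul_le_two_mul_of_saturated β 1 isUnit_det_one_fin_two (by rw [hfilter, hcard]; ring)
    omega
  | succ d ih =>
    intro ι _ _ β O hO hO' hcard
    obtain ⟨ρ, hrel, j₀, hj₀, hρ⟩ := exists_relation β O (by omega)
    let β' := split (β := β) (ρ := ρ) (j₀ := j₀) O hO hO' hrel hj₀ hρ
    have hcard' : ((O.erase j₀).map Function.Embedding.inl : Finset (ι ⊕ Fin 2)).card = 2 * n + d := by
      rw [Finset.card_map, Finset.card_erase_of_mem hj₀, hcard]; omega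
    have h := ih β' ((O.erase j₀).map Function.Embedding.inl)
      (split_f_one_eq_zero O hO hO' hrel hj₀ hρ) (split_f_one_ne_zero O hO hO' hrel hj₀ hρ) hcard'
    rw [Fintype.card_sum, Fintype.card_fin] at h
    omega

section Census

variable [DecidableEq k]

/-- **THE QUARTER LAW (any field, any invertible point).** For an `r`-term bilinear computation of `⟨2,2,n⟩` and an invertible `X₀`
with `p` nonvanishing X-forms: `15n ≤ 2r + 4p`, i.e. `p ≥ 2n + (7n − 2r)/4`. (Transport `X₀` to `1`, then
`seven_mul_le_of_card_eq_add` with `d = p − 2n`; `p ≥ 2n` is the invertible-point cap.) -/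
theorem fifteen_mul_le (β : BilinComp (mulBilin k 2 2 n) ι) (X₀ : Matrix (Fin 2) (Fin 2) k) (hX₀ : IsUnit X₀.det) :
    15 * n ≤ 2 * Fintype.card ι + 4 * (Finset.univ.filter fun i => β.f i X₀ ≠ 0).card := by
  classical
  have hcap : 2 * n ≤ (Finset.univ.filter fun i => β.f i X₀ ≠ 0).card := by
    convert DeltaLaw.two_mul_le_card_filter_ne β X₀ hX₀
  obtain ⟨β', hf, -, -⟩ := exists_XsideTransform β X₀ X₀⁻¹ 1 1 (Matrix.mul_nonsing_inv X₀ hX₀) (Matrix.one_mul 1)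
  have hf1 : ∀ i, β'.f i 1 = β.f i X₀ := fun i => by rw [hf, Matrix.mul_one, Matrix.mul_one]
  set O := Finset.univ.filter fun i => β.f i X₀ ≠ 0 with hOdef
  have hO : ∀ i, i ∉ O → β'.f i 1 = 0 := fun i hi => by
    rw [hf1]; by_contra h; exact hi (Finset.mem_filter.mpr ⟨Finset.mem_univ i, h⟩)
  have hO' : ∀ i ∈ O, β'.f i 1 ≠ 0 := fun i hi => by rw [hf1]; exact (Finset.mem_filter.mp hi).2
  obtain ⟨d, hd⟩ := Nat.exists_eq_add_of_le hcap
  have h := seven_mul_le_of_card_eq_add d β' O hO hO' hd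
  omega

/-- **Near points need `2r + 4 ≥ 7n` (any field).** If an `r`-term computation of `⟨2,2,n⟩` has an invertible `X₀` with exactly
`2n + 1` nonvanishing X-forms (a NEAR point: `r − 2n − 1` forms vanish, one below the cap), then `7n ≤ 2r + 4`. -/
theorem seven_mul_le_two_mul_add_four_of_near (β : BilinComp (mulBilin k 2 2 n) ι) (X₀ : Matrix (Fin 2) (Fin 2) k)
    (hX₀ : IsUnit X₀.det) (hnear : (Finset.univ.filter fun i => β.f i X₀ ≠ 0).card = 2 * n + 1) :
    7 * n ≤ 2 * Fintype.card ι + 4 := by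
  have h := fifteen_mul_le β X₀ hX₀
  omega

/-- **Census form.** If `2r + 4 < 7n`, every invertible point of an `r`-term computation of `⟨2,2,n⟩` has at least `2n + 2`
nonvanishing X-forms (neither saturated nor near: at most `r − 2n − 2` vanish). -/
theorem two_mul_add_two_le_card_filter_ne (β : BilinComp (mulBilin k 2 2 n) ι) (h : 2 * Fintype.card ι + 4 < 7 * n)
    (X₀ : Matrix (Fin 2) (Fin 2) k) (hX₀ : IsUnit X₀.det) :
    2 * n + 2 ≤ (Finset.univ.filter fun i => β.f i X₀ ≠ 0).card := by
  have h' := fifteen_mul_le β X₀ hX₀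
  omega

/-- **36-term `⟨2,2,11⟩` (any field; the floor rung `⌈36·11/11⌉` of the `𝔽₃` census):** at every invertible point at least 24 of the
36 X-forms are nonzero (at most 12 vanish; the plain cap allows 14, the δ-law 13). -/
theorem twentyfour_le_card_filter_ne_2211_36 (β : BilinComp (mulBilin k 2 2 11) ι) (hι : Fintype.card ι = 36)
    (X₀ : Matrix (Fin 2) (Fin 2) k) (hX₀ : IsUnit X₀.det) : 24 ≤ (Finset.univ.filter fun i => β.f i X₀ ≠ 0).card :=
  two_mul_add_two_le_card_filter_ne β (by rw [hι]; norm_num) X₀ hX₀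

/-- **43-term `⟨2,2,13⟩` (any field; floor rung):** at every invertible point at least 28 of the 43 X-forms are nonzero. -/
theorem twentyeight_le_card_filter_ne_2213_43 (β : BilinComp (mulBilin k 2 2 13) ι) (hι : Fintype.card ι = 43)
    (X₀ : Matrix (Fin 2) (Fin 2) k) (hX₀ : IsUnit X₀.det) : 28 ≤ (Finset.univ.filter fun i => β.f i X₀ ≠ 0).card :=
  two_mul_add_two_le_card_filter_ne β (by rw [hι]; norm_num) X₀ hX₀

/-- **72-term `⟨2,2,22⟩` (any field; floor rung):** at every invertible point at least 47 of the 72 X-forms are nonzero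
(`15·22 = 330 ≤ 144 + 4p` forces `p ≥ 47 = 2n + 3`: three below the plain cap). -/
theorem fortyseven_le_card_filter_ne_2222_72 (β : BilinComp (mulBilin k 2 2 22) ι) (hι : Fintype.card ι = 72)
    (X₀ : Matrix (Fin 2) (Fin 2) k) (hX₀ : IsUnit X₀.det) : 47 ≤ (Finset.univ.filter fun i => β.f i X₀ ≠ 0).card := by
  have h := fifteen_mul_le β X₀ hX₀
  rw [hι] at h
  omega

end Census

end NearSplit

end Summit.MatrixMultiplication.OmegaCensus.SmallFormats
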